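import Literature.NumberTheory.EllipticCurves.TowerCompatibleFamiliesKonigProofs
import HarnessLib

/-!
# The range and the cokernel of a map between PINNED inverse limits with finite source levels
# (Kőnig for fibres; the cokernel of a limit map is bounded by the eventual level-wise indices) — theorems only

Topic `NumberTheory/EllipticCurves` (companion of `TowerCompatibleFamiliesKonigProofs`, §1 `Tower` of
`ZpExtensionEisensteinSelmerStructure`). No definition, no named fact, no instance, no `sorry`.

SETTING. Two towers of abelian groups `… → A_{j+1} → A_j → …` (`redA`, FINITE levels) and `… → B_{j+1} → B_j → …`
(`redB`), level maps `φ_j : A_j → B_j` commuting with the reductions, and two PINNED limits in the style of the tree's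
`WeierstrassCurve.LambdaAdicSelmerData` / `ZpExtension.EisensteinH1Data`: an abelian group `S` with projections
`πS_j : S → A_j` onto which every compatible family of the `A`-tower lifts (`hS`, the `surj` field), and an abelian group
`H` with projections `πH_j : H → B_j` compatible with `redB` (`hπH`, the `proj_reduce` field) and jointly injective
(`hH`, the `ext` field); finally a map `f : S → H` given level-wise by the `φ_j` (`hf : πH_j (f s) = φ_j (πS_j s)`, the
shape of `LambdaAdicSelmerData.proj_toEisensteinH1Linear`). For Howard's control map
`𝔖 = lim H¹(K_n, E[p^k]) → H¹(K, T_𝔮) = lim_k H¹(K, T_𝔮/p^k)` ([Howard 2004, §3.2, Lemma 3.2.7 / Prop. 3.2.8];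
[Mazur–Rubin 2004, Prop. 5.3.14]) these are `𝔖`, the pinned `H¹(K, T_𝔮)`, and the finite-level corestriction maps.

WHAT IS HERE (the compactness half of any cokernel bound for such an `f`, i.e. of the field
`SpecWitness.card_coker_le` of the cell's μ-residual; pure algebra + Kőnig):
* `Tower.exists_eq_of_forall_mem_range` / `Tower.mem_range_iff_forall_mem_range`: **`h ∈ H` is in the range of `f`
  iff every projection `πH_j h` is in the range of `φ_j`** (Kőnig: the fibres `{a ∈ A_j | φ_j a = πH_j h}` are finite,
  non-empty and mapped into each other by `redA`; a section of this inverse system — Mathlib's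
  `nonempty_sections_of_finite_inverse_system` — is a compatible family, which lifts to `S` by `hS`, and `hH` concludes).
* `Tower.range_le_comap_range`, `Tower.comap_range_succ_le`, `Tower.iInf_comap_range_eq_range`: the subgroups
  `T_j = πH_j⁻¹(range φ_j) ≤ H` decrease with `j`, contain `range f`, and **`⨅_j T_j = range f`**.
* `Tower.finite_quotient_comap_range`: `H ⧸ T_j` is finite when `B_j` is.
* `Tower.finite_quotient_range_and_natCard_le_of_forall` (+ the two projections `finite_quotient_range_of_forall`,
  `natCard_quotient_range_le_of_forall`): **if `B_j` is finite and `#(H ⧸ T_j) ≤ C` for every `j`, then `H ⧸ range f`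
  is finite of order `≤ C`** (the indices `#(H ⧸ T_j)` increase with `j` and are bounded, hence eventually constant;
  a surjection between finite sets of the same size is a bijection, so `T_j` is eventually constant `= ⨅_j T_j = range f`).
  So an m-UNIFORM bound on the cokernel of Howard's control map at `𝔮_m` is EQUIVALENT to level-wise bounds on
  «classes of `H¹(K, T_𝔮/p^k)` coming from `H` modulo corestrictions of level-`(n, k)` Selmer classes», uniform in `k`
  (the converse inequality `#(H ⧸ T_j) ≤ #(H ⧸ range f)` being trivial from `range f ≤ T_j`).

NOT here: any Galois cohomology; the instantiation to `LambdaAdicSelmerData.toEisensteinH1Linear` (which needs the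
corestriction / reduction compatibilities of the finite Selmer groups `Sel_{p^k}(E/K_n)`); the arithmetic of the
level-wise indices (local terms at `v ∣ p`, and the global term `𝒳[𝔮_m] ⊕ Ш²_Σ(K, 𝐓)[𝔮_m]`, uniform for `m ≥ m₀` by
`IwasawaAlgebra.exists_forall_torsionBy_X_pow_add_C_le`). BSD is not proved by any of this.

References: [Howard2004HeegnerKolyvagin] B. Howard, *The Heegner point Kolyvagin system*, Compositio Math. 140 (2004),
§3.2 (arXiv:1202.6340 pp. 16–17: Lemma 3.2.7, Prop. 3.2.8, proof of Thm. 3.2.10 at `𝔮 = T^m + p`);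
[MazurRubinMemoirs2004] B. Mazur, K. Rubin, *Kolyvagin systems*, Mem. AMS 799 (2004), Lemma 5.3.13, Prop. 5.3.14;
[SerreGaloisCohomology1997] J.-P. Serre, *Galois Cohomology*, I §2.2 (limits of finite modules, compactness);
[NeukirchSchmidtWingberg2008] Cor. 2.7.6 (Mittag-Leffler for finite systems).
-/

noncomputable section

open CategoryTheory

universe u v w w'

namespace Literature.NumberTheory.EllipticCurves

namespace Tower

variable {A : ℕ → Type u} [∀ j, AddCommGroup (A j)] {redA : ∀ j, A (j + 1) →+ A j}
  {B : ℕ → Type v} [∀ j, AddCommGroup (B j)] {redB : ∀ j, B (j + 1) →+ B j}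
  {φ : ∀ j, A j →+ B j}
  {S : Type w} [AddCommGroup S] {πS : ∀ j, S →+ A j}
  {H : Type w'} [AddCommGroup H] {πH : ∀ j, H →+ B j}
  {f : S →+ H}

/-! ### Kőnig: the range of a limit map is cut out level-wise -/

/-- **Kőnig's lemma for the fibres of a map between pinned inverse limits.** Let the source levels `A_j` be finite,
the level maps `φ_j` commute with the reductions (`hφ`), every compatible family of the `A`-tower lift to `S` (`hS`),
the projections of `H` be compatible (`hπH`) and jointly injective (`hH`), and `f` be given level-wise by `φ` (`hf`).
If every projection `πH_j h` of `h ∈ H` is in the range of `φ_j`, then `h = f s` for some `s ∈ S`. Proof: the fibres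
`{a ∈ A_j | φ_j a = πH_j h}` form an inverse system of finite non-empty sets; a section (Mathlib
`nonempty_sections_of_finite_inverse_system`) is a compatible family mapping to `(πH_j h)_j`; lift it to `S`.
[cite: SerreGaloisCohomology1997, Ch. I §2.2 (limits of finite modules; compactness)]
[cite: Howard2004HeegnerKolyvagin, §3.2, Prop. 3.2.8 (the control map 𝔖 → H¹(K, T_𝔮))] -/
theorem exists_eq_of_forall_mem_range [∀ j, Finite (A j)]
    (hφ : ∀ (j : ℕ) (a : A (j + 1)), redB j (φ (j + 1) a) = φ j (redA j a))
    (hS : ∀ x ∈ compatibleFamilies redA, ∃ s : S, ∀ j, πS j s = x j)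
    (hπH : ∀ (j : ℕ) (h : H), redB j (πH (j + 1) h) = πH j h)
    (hH : ∀ h : H, (∀ j, πH j h = 0) → h = 0)
    (hf : ∀ (j : ℕ) (s : S), πH j (f s) = φ j (πS j s))
    (h : H) (hh : ∀ j, πH j h ∈ (φ j).range) : ∃ s : S, f s = h := by
  classical
  -- the finite non-empty fibres over the projections of `h`
  let C : ℕ → Type u := fun ℓ ↦ {a : A ℓ // φ ℓ a = πH ℓ h}
  haveI hCne : ∀ ℓ, Nonempty (C ℓ) := fun ℓ ↦ by
    obtain ⟨a, ha⟩ := hh ℓ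
    exact ⟨⟨a, ha⟩⟩
  haveI : ∀ ℓ, Finite (C ℓ) := fun ℓ ↦ Subtype.finite
  -- the transition maps `C (ℓ+1) → C ℓ`, `a ↦ redA a`
  let t : ∀ ℓ, C (ℓ + 1) → C ℓ := fun ℓ a ↦
    ⟨redA ℓ a.1, by rw [← hφ, a.2, hπH]⟩
  let F : ℕᵒᵖ ⥤ Type u := Functor.ofOpSequence (X := C) (fun ℓ ↦ TypeCat.ofHom (t ℓ))
  haveI : ∀ j : ℕᵒᵖ, Finite (F.obj j) := fun j ↦ by
    change Finite (C j.unop); infer_instance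
  haveI : ∀ j : ℕᵒᵖ, Nonempty (F.obj j) := fun j ↦ by
    change Nonempty (C j.unop); infer_instance
  obtain ⟨sec, hsec⟩ := nonempty_sections_of_finite_inverse_system F
  -- the section is a compatible family of the `A`-tower …
  let x : Π j, A j := fun j ↦ (sec (Opposite.op j) : C j).1
  have hx : x ∈ compatibleFamilies redA := by
    rw [mem_compatibleFamilies_iff]
    intro j
    have hsj := hsec (homOfLE (Nat.le_add_right j 1)).op
    rw [Functor.ofOpSequence_map_homOfLE_succ] at hsj
    -- `hsj : t j (sec (op (j+1))) = sec (op j)`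
    exact congrArg Subtype.val hsj
  -- … through the fibres, hence lifts to `S`
  obtain ⟨s, hs⟩ := hS x hx
  refine ⟨s, ?_⟩
  rw [← sub_eq_zero]
  refine hH _ fun j ↦ ?_
  rw [map_sub, sub_eq_zero, hf, hs]
  exact (sec (Opposite.op j) : C j).2

/-- **The range of a map between pinned inverse limits (finite source levels) is cut out level-wise**:
`h ∈ range f ↔ ∀ j, πH_j h ∈ range φ_j`. [cite: SerreGaloisCohomology1997, Ch. I §2.2]
[cite: Howard2004HeegnerKolyvagin, §3.2, Prop. 3.2.8] -/
theorem mem_range_iff_forall_mem_range [∀ j, Finite (A j)]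
    (hφ : ∀ (j : ℕ) (a : A (j + 1)), redB j (φ (j + 1) a) = φ j (redA j a))
    (hS : ∀ x ∈ compatibleFamilies redA, ∃ s : S, ∀ j, πS j s = x j)
    (hπH : ∀ (j : ℕ) (h : H), redB j (πH (j + 1) h) = πH j h)
    (hH : ∀ h : H, (∀ j, πH j h = 0) → h = 0)
    (hf : ∀ (j : ℕ) (s : S), πH j (f s) = φ j (πS j s))
    (h : H) : h ∈ f.range ↔ ∀ j, πH j h ∈ (φ j).range := by
  constructor
  · rintro ⟨s, rfl⟩ j
    exact ⟨πS j s, (hf j s).symm⟩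
  · intro hh
    obtain ⟨s, hs⟩ := exists_eq_of_forall_mem_range hφ hS hπH hH hf h hh
    exact ⟨s, hs⟩

/-! ### A surjectivity helper -/

/-- For subgroups `N ≤ M` of an abelian group, the canonical map `H ⧸ N → H ⧸ M` is onto. [folklore] -/
private theorem quotientMap_surjective_of_le {N M : AddSubgroup H}
    (h : N ≤ M.comap (AddMonoidHom.id H)) :
    Function.Surjective (QuotientAddGroup.map N M (AddMonoidHom.id H) h) := by
  intro x
  induction x using QuotientAddGroup.induction_on with
  | H z => exact ⟨(z : H ⧸ N), rfl⟩

/-! ### The subgroups `T_j = πH_j⁻¹(range φ_j)` -/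

/-- `range f ≤ πH_j⁻¹(range φ_j)` for every `j` (no finiteness needed): the image of the limit map projects into
the images of the level maps. [cite: Howard2004HeegnerKolyvagin, §3.2, Prop. 3.2.8 (the control map is given level-wise)]
[cite: SerreGaloisCohomology1997, Ch. I §2.2] -/
theorem range_le_comap_range (hf : ∀ (j : ℕ) (s : S), πH j (f s) = φ j (πS j s)) (j : ℕ) :
    f.range ≤ ((φ j).range).comap (πH j) := by
  rintro _ ⟨s, rfl⟩
  exact ⟨πS j s, (hf j s).symm⟩

/-- The subgroups `T_j = πH_j⁻¹(range φ_j)` decrease with `j`: `T_{j+1} ≤ T_j` (no finiteness needed; the level maps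
commute with the reductions). [cite: SerreGaloisCohomology1997, Ch. I §2.2 (inverse systems of finite modules)]
[cite: Howard2004HeegnerKolyvagin, §3.2, Prop. 3.2.8] -/
theorem comap_range_succ_le
    (hφ : ∀ (j : ℕ) (a : A (j + 1)), redB j (φ (j + 1) a) = φ j (redA j a))
    (hπH : ∀ (j : ℕ) (h : H), redB j (πH (j + 1) h) = πH j h) (j : ℕ) :
    ((φ (j + 1)).range).comap (πH (j + 1)) ≤ ((φ j).range).comap (πH j) := by
  rintro h ⟨a, ha⟩
  refine ⟨redA j a, ?_⟩
  rw [← hφ, ha, hπH]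

/-- The subgroups `T_j` are antitone in `j`: `j ≤ j' → T_{j'} ≤ T_j`.
[cite: SerreGaloisCohomology1997, Ch. I §2.2 (inverse systems of finite modules)] -/
theorem comap_range_le_of_le
    (hφ : ∀ (j : ℕ) (a : A (j + 1)), redB j (φ (j + 1) a) = φ j (redA j a))
    (hπH : ∀ (j : ℕ) (h : H), redB j (πH (j + 1) h) = πH j h) {j j' : ℕ} (hjj' : j ≤ j') :
    ((φ j').range).comap (πH j') ≤ ((φ j).range).comap (πH j) := by
  have hanti : Antitone fun j ↦ ((φ j).range).comap (πH j) :=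
    antitone_nat_of_succ_le fun j ↦ comap_range_succ_le hφ hπH j
  exact hanti hjj'

/-- **`⨅_j πH_j⁻¹(range φ_j) = range f`** (finite source levels; Kőnig). [cite: SerreGaloisCohomology1997, Ch. I §2.2]
[cite: Howard2004HeegnerKolyvagin, §3.2, Prop. 3.2.8] -/
theorem iInf_comap_range_eq_range [∀ j, Finite (A j)]
    (hφ : ∀ (j : ℕ) (a : A (j + 1)), redB j (φ (j + 1) a) = φ j (redA j a))
    (hS : ∀ x ∈ compatibleFamilies redA, ∃ s : S, ∀ j, πS j s = x j)
    (hπH : ∀ (j : ℕ) (h : H), redB j (πH (j + 1) h) = πH j h)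
    (hH : ∀ h : H, (∀ j, πH j h = 0) → h = 0)
    (hf : ∀ (j : ℕ) (s : S), πH j (f s) = φ j (πS j s)) :
    ⨅ j, ((φ j).range).comap (πH j) = f.range := by
  apply le_antisymm
  · intro h hh
    rw [AddSubgroup.mem_iInf] at hh
    exact (mem_range_iff_forall_mem_range hφ hS hπH hH hf h).2 hh
  · exact le_iInf fun j ↦ range_le_comap_range hf j

/-- `H ⧸ πH_j⁻¹(range φ_j)` is finite as soon as `B_j` is (it is a quotient of `H ⧸ ker πH_j ≅ range πH_j ≤ B_j`):
the level-wise indices of Howard's Prop. 3.2.8 are finite because the finite-level cohomology groups are.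
[cite: Howard2004HeegnerKolyvagin, §3.2, Lemma 3.2.7 / Prop. 3.2.8 (finite kernels and cokernels)]
[cite: SerreGaloisCohomology1997, Ch. I §2.2] -/
theorem finite_quotient_comap_range (j : ℕ) [Finite (B j)] :
    Finite (H ⧸ ((φ j).range).comap (πH j)) := by
  have hle : (πH j).ker ≤ ((φ j).range).comap (πH j) := by
    intro h hh
    rw [AddMonoidHom.mem_ker] at hh
    change πH j h ∈ (φ j).range
    rw [hh]
    exact zero_mem _
  haveI : Finite (πH j).range := inferInstance
  haveI : Finite (H ⧸ (πH j).ker) :=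
    Finite.of_equiv _ (QuotientAddGroup.quotientKerEquivRange (πH j)).toEquiv.symm
  exact Finite.of_surjective (QuotientAddGroup.map _ _ (AddMonoidHom.id H) hle)
    (quotientMap_surjective_of_le hle)

/-! ### The cokernel of the limit map from level-wise index bounds -/

/-- **The cokernel of a map between pinned inverse limits is bounded by the level-wise indices.** With finite source
levels `A_j` and finite `B_j`: if `#(H ⧸ πH_j⁻¹(range φ_j)) ≤ C` for every `j`, then `H ⧸ range f` is finite and
`#(H ⧸ range f) ≤ C`. Proof: the indices increase with `j` (the `T_j` decrease) and are bounded by `C`, hence eventually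
constant; a surjection between finite sets of equal size is a bijection, so `T_j = T_{j₀}` for `j ≥ j₀`, whence
`range f = ⨅_j T_j = T_{j₀}`. This is the compactness step of Howard's Prop. 3.2.8 / Mazur–Rubin's Prop. 5.3.14 in the
pinned-limit currency: an m-uniform bound on the cokernel of `𝔖 → H¹(K, T_{𝔮_m})` is the same as level-wise bounds,
uniform in the level. [cite: Howard2004HeegnerKolyvagin, §3.2, Prop. 3.2.8 (arXiv:1202.6340 p. 17)]
[cite: MazurRubinMemoirs2004, Prop. 5.3.14] [cite: SerreGaloisCohomology1997, Ch. I §2.2] -/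
theorem finite_quotient_range_and_natCard_le_of_forall [∀ j, Finite (A j)] [∀ j, Finite (B j)]
    (hφ : ∀ (j : ℕ) (a : A (j + 1)), redB j (φ (j + 1) a) = φ j (redA j a))
    (hS : ∀ x ∈ compatibleFamilies redA, ∃ s : S, ∀ j, πS j s = x j)
    (hπH : ∀ (j : ℕ) (h : H), redB j (πH (j + 1) h) = πH j h)
    (hH : ∀ h : H, (∀ j, πH j h = 0) → h = 0)
    (hf : ∀ (j : ℕ) (s : S), πH j (f s) = φ j (πS j s))
    (C : ℕ) (hC : ∀ j, Nat.card (H ⧸ ((φ j).range).comap (πH j)) ≤ C) :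
    Finite (H ⧸ f.range) ∧ Nat.card (H ⧸ f.range) ≤ C := by
  classical
  -- notation: `T j`, the indices `c j = #(H ⧸ T j)`
  set T : ℕ → AddSubgroup H := fun j ↦ ((φ j).range).comap (πH j) with hT
  haveI hfin : ∀ j, Finite (H ⧸ T j) := fun j ↦ finite_quotient_comap_range j
  have hanti : ∀ {j j' : ℕ}, j ≤ j' → T j' ≤ T j := fun hjj' ↦ comap_range_le_of_le hφ hπH hjj'
  -- the canonical surjections `H ⧸ T j' → H ⧸ T j` for `j ≤ j'`
  have hsurj : ∀ {j j' : ℕ} (hjj' : j ≤ j'),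
      Function.Surjective (QuotientAddGroup.map (T j') (T j) (AddMonoidHom.id H) (hanti hjj')) :=
    fun hjj' ↦ quotientMap_surjective_of_le (hanti hjj')
  let c : ℕ → ℕ := fun j ↦ Nat.card (H ⧸ T j)
  have hmono : Monotone c := by
    refine monotone_nat_of_le_succ fun j ↦ ?_
    exact Nat.card_le_card_of_surjective _ (hsurj (Nat.le_succ j))
  have hbdd : BddAbove (Set.range c) := ⟨C, by rintro _ ⟨j, rfl⟩; exact hC j⟩
  -- the bounded increasing sequence of indices attains its supremum at some `j₀` and is constant from there
  obtain ⟨j₀, hj₀⟩ : ∃ j₀, c j₀ = sSup (Set.range c) := by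
    have hmem := Nat.sSup_mem (Set.range_nonempty c) hbdd
    obtain ⟨j₀, hj₀⟩ := hmem
    exact ⟨j₀, hj₀⟩
  have hconst : ∀ j, j₀ ≤ j → c j = c j₀ := by
    intro j hj
    apply le_antisymm
    · rw [hj₀]
      exact le_csSup hbdd ⟨j, rfl⟩
    · exact hmono hj
  -- hence `T j = T j₀` for `j ≥ j₀`: the surjection `H ⧸ T j → H ⧸ T j₀` is a bijection
  have hstab : ∀ j, j₀ ≤ j → T j₀ ≤ T j := by
    intro j hj x hx
    have hbij : Function.Bijective (QuotientAddGroup.map (T j) (T j₀) (AddMonoidHom.id H) (hanti hj)) :=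
      (hsurj hj).bijective_of_nat_card_le (le_of_eq (hconst j hj))
    have h0 : QuotientAddGroup.map (T j) (T j₀) (AddMonoidHom.id H) (hanti hj) (x : H ⧸ T j) = 0 := by
      rw [QuotientAddGroup.map_mk, AddMonoidHom.id_apply, QuotientAddGroup.eq_zero_iff]
      exact hx
    have hx0 : (x : H ⧸ T j) = 0 := hbij.1 (by rw [h0, map_zero])
    exact (QuotientAddGroup.eq_zero_iff x).1 hx0
  -- so `range f = ⨅ T = T j₀`
  have hiInf : ⨅ j, T j = T j₀ := by
    apply le_antisymm (iInf_le _ _)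
    refine le_iInf fun j ↦ ?_
    rcases le_total j₀ j with hj | hj
    · exact hstab j hj
    · exact hanti hj
  have hrange : f.range = T j₀ := by
    rw [← hiInf, hT]
    exact (iInf_comap_range_eq_range hφ hS hπH hH hf).symm
  -- transport finiteness and the count along `H ⧸ range f ≃ H ⧸ T j₀`
  let e : H ⧸ f.range ≃+ H ⧸ T j₀ := QuotientAddGroup.quotientAddEquivOfEq hrange
  refine ⟨Finite.of_equiv _ e.toEquiv.symm, ?_⟩
  rw [Nat.card_congr e.toEquiv]
  exact hC j₀

/-- Projection of `finite_quotient_range_and_natCard_le_of_forall`: finiteness of the cokernel.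
[cite: Howard2004HeegnerKolyvagin, §3.2, Prop. 3.2.8] -/
theorem finite_quotient_range_of_forall [∀ j, Finite (A j)] [∀ j, Finite (B j)]
    (hφ : ∀ (j : ℕ) (a : A (j + 1)), redB j (φ (j + 1) a) = φ j (redA j a))
    (hS : ∀ x ∈ compatibleFamilies redA, ∃ s : S, ∀ j, πS j s = x j)
    (hπH : ∀ (j : ℕ) (h : H), redB j (πH (j + 1) h) = πH j h)
    (hH : ∀ h : H, (∀ j, πH j h = 0) → h = 0)
    (hf : ∀ (j : ℕ) (s : S), πH j (f s) = φ j (πS j s))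
    (C : ℕ) (hC : ∀ j, Nat.card (H ⧸ ((φ j).range).comap (πH j)) ≤ C) :
    Finite (H ⧸ f.range) :=
  (finite_quotient_range_and_natCard_le_of_forall hφ hS hπH hH hf C hC).1

/-- Projection of `finite_quotient_range_and_natCard_le_of_forall`: the count `#(H ⧸ range f) ≤ C`.
[cite: Howard2004HeegnerKolyvagin, §3.2, Prop. 3.2.8] -/
theorem natCard_quotient_range_le_of_forall [∀ j, Finite (A j)] [∀ j, Finite (B j)]
    (hφ : ∀ (j : ℕ) (a : A (j + 1)), redB j (φ (j + 1) a) = φ j (redA j a))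
    (hS : ∀ x ∈ compatibleFamilies redA, ∃ s : S, ∀ j, πS j s = x j)
    (hπH : ∀ (j : ℕ) (h : H), redB j (πH (j + 1) h) = πH j h)
    (hH : ∀ h : H, (∀ j, πH j h = 0) → h = 0)
    (hf : ∀ (j : ℕ) (s : S), πH j (f s) = φ j (πS j s))
    (C : ℕ) (hC : ∀ j, Nat.card (H ⧸ ((φ j).range).comap (πH j)) ≤ C) :
    Nat.card (H ⧸ f.range) ≤ C :=
  (finite_quotient_range_and_natCard_le_of_forall hφ hS hπH hH hf C hC).2

/-- **Trivial converse**: the level-wise index `#(H ⧸ πH_j⁻¹(range φ_j))` never exceeds `#(H ⧸ range f)` (when the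
latter is finite), since `range f ≤ πH_j⁻¹(range φ_j)`. So the level-wise bounds are NECESSARY as well as sufficient.
[cite: Howard2004HeegnerKolyvagin, §3.2, Prop. 3.2.8] [cite: SerreGaloisCohomology1997, Ch. I §2.2] -/
theorem natCard_quotient_comap_range_le_natCard_quotient_range
    (hf : ∀ (j : ℕ) (s : S), πH j (f s) = φ j (πS j s)) [Finite (H ⧸ f.range)] (j : ℕ) :
    Nat.card (H ⧸ ((φ j).range).comap (πH j)) ≤ Nat.card (H ⧸ f.range) :=
  Nat.card_le_card_of_surjective (QuotientAddGroup.map _ _ (AddMonoidHom.id H) (range_le_comap_range hf j))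
    (quotientMap_surjective_of_le (range_le_comap_range hf j))

/-! ### Module version (the consumer's currency: `LinearMap.range`, `Submodule` quotients) -/

section Module

variable {R : Type*} [Ring R] {S' : Type w} [AddCommGroup S'] [Module R S'] {H' : Type w'} [AddCommGroup H']
  [Module R H'] {πS' : ∀ j, S' →+ A j} {πH' : ∀ j, H' →+ B j} {g : S' →ₗ[R] H'}

/-- **Module form of the cokernel bound** (for an `R`-linear `g : S → H` between pinned limits whose projections are
merely additive, as for `LambdaAdicSelmerData.toEisensteinH1Linear` and `EisensteinH1Data.proj`): under the same
level-wise hypotheses, `H ⧸ LinearMap.range g` is finite of order `≤ C` — the shape of the fields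
`SpecWitness.finite_coker` / `SpecWitness.card_coker_le`. [cite: Howard2004HeegnerKolyvagin, §3.2, Prop. 3.2.8]
[cite: MazurRubinMemoirs2004, Prop. 5.3.14] -/
theorem finite_quotient_linearRange_and_natCard_le_of_forall [∀ j, Finite (A j)] [∀ j, Finite (B j)]
    (hφ : ∀ (j : ℕ) (a : A (j + 1)), redB j (φ (j + 1) a) = φ j (redA j a))
    (hS : ∀ x ∈ compatibleFamilies redA, ∃ s : S', ∀ j, πS' j s = x j)
    (hπH : ∀ (j : ℕ) (h : H'), redB j (πH' (j + 1) h) = πH' j h)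
    (hH : ∀ h : H', (∀ j, πH' j h = 0) → h = 0)
    (hg : ∀ (j : ℕ) (s : S'), πH' j (g s) = φ j (πS' j s))
    (C : ℕ) (hC : ∀ j, Nat.card (H' ⧸ ((φ j).range).comap (πH' j)) ≤ C) :
    Finite (H' ⧸ LinearMap.range g) ∧ Nat.card (H' ⧸ LinearMap.range g) ≤ C := by
  have key := finite_quotient_range_and_natCard_le_of_forall (f := g.toAddMonoidHom) hφ hS hπH hH hg C hC
  -- `H ⧸ LinearMap.range g` and `H ⧸ g.toAddMonoidHom.range` are the same quotient
  have hrel : (LinearMap.range g).toAddSubgroup = g.toAddMonoidHom.range := LinearMap.range_toAddSubgroup g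
  let e : (H' ⧸ LinearMap.range g) ≃ (H' ⧸ g.toAddMonoidHom.range) :=
    (QuotientAddGroup.quotientAddEquivOfEq hrel).toEquiv
  haveI := key.1
  exact ⟨Finite.of_equiv _ e.symm, (Nat.card_congr e).trans_le key.2⟩

end Module

end Tower

end Literature.NumberTheory.EllipticCurves

end
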